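import Mathlib
import Literature.NumberTheory.LFunctions.WeilArchimedeanMoments
import Literature.NumberTheory.LFunctions.WeilChirpDecay
import HarnessLib

/-!
# The window transform on `L²([-a,a])`: Plancherel's inequality and the band form for cut window functions (handoff prove-1, ATTEMPT-18 §1; the `L²` plumbing of step (TB-3) of LEMMA TB)

Step (TB-3) of LEMMA TB (HOME handoff/IDEAS-prolate.md §87.4) splits a window test `g`
(`tsupport g ⊆ [-a, a]`) in `L²([-a, a])` as `g = u + w` with `u` the Legendre section (a
POLYNOMIAL on the window, cut off at `±a` — not a Weil test) and `w ⊥ u`.  The tree's band-form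
lemmas (`HandoffBandForm`) are stated for Weil tests; this file supplies the same facts for CUT
WINDOW FUNCTIONS `1_{[-a,a]} v` with `v` continuous, through the window transform

  `F_a v (t) = ∫_{-a}^{a} v(x) e^{itx} dx = (1_{[-a,a]} v)^(1/2 + it)`

(`windowFT`; for a test supported in the window it IS `ĝ(1/2 + it)`):
* `integral_norm_sq_weilMellin_half_line_of_memLp` — Plancherel `∫ |ĝ(1/2+it)|² dt = 2π ‖g‖₂²`
  for every `g ∈ L¹ ∩ L²` (the tree's `integral_norm_sq_weilMellin_half_line` assumed a Weil test;
  the proof is the same, from `Literature.Analysis.FunctionSpaces.integral_norm_sq_fourierIntegral_eq`);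
* `setIntegral_norm_sq_windowFT_le` — PLANCHEREL'S INEQUALITY `∫_S |F_a v|² ≤ 2π ∫_{-a}^{a} |v|²`
  for any measurable frequency set `S` (`0 ≤ P ≤ I` for the time–band limiting operator on cut
  window functions — the input `P_uu ≤ X²` of `HandoffLegendreLeakage.twoBand_section_lower`);
* `norm_sq_setIntegral_windowFT_mul_conj_le`, `setIntegral_norm_sq_windowFT_add` — Cauchy–Schwarz
  and the expansion of the band form of a sum (the cross term `R` of the 2×2 step).

Nothing in this file bears on the truth of RH; no property of `ζ` is used.
-/

set_option linter.dupNamespace false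

open scoped Real ComplexConjugate FourierTransform
open Complex MeasureTheory Set Filter Literature.NumberTheory.LFunctions

namespace Summit.RiemannHypothesis.RiemannHypothesis.Theorems

variable {a : ℝ} {v u w g : ℝ → ℂ}

/-! ### Plancherel on the critical line for `L¹ ∩ L²` -/

/-- **Plancherel in the `weilMellin` normalisation for `g ∈ L¹ ∩ L²`:**
`∫ ‖ĝ(1/2 + it)‖² dt = 2π ‖g‖₂²` (the tree's `integral_norm_sq_weilMellin_half_line` without the
smoothness hypothesis; Titchmarsh, *Fourier Integrals*, Thm. 48). -/
theorem integral_norm_sq_weilMellin_half_line_of_memLp (h1 : Integrable g) (h2 : MemLp g 2) :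
    ∫ t : ℝ, ‖weilMellin g (1 / 2 + t * I)‖ ^ 2 = 2 * π * weilNorm2Sq g := by
  have hP := Literature.Analysis.FunctionSpaces.integral_norm_sq_fourierIntegral_eq h1 h2
  have hF : ∀ w : ℝ, 𝓕 g w = weilMellin g (1 / 2 + ((-(2 * π * w) : ℝ) : ℂ) * I) := by
    intro w
    have h := fourier_weilKernel g (1 / 2) w
    have e : (fun t : ℝ ↦ g t * cexp ((((1 / 2 : ℝ) : ℂ) - 1 / 2) * t)) = g := by
      funext t; push_cast; simp
    rw [e] at h
    rw [h]
    push_cast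
    ring_nf
  set f : ℝ → ℝ := fun t ↦ ‖weilMellin g (1 / 2 + t * I)‖ ^ 2 with hf
  have hsub := Measure.integral_comp_mul_left f (-(2 * π))
  have e1 : (fun w : ℝ ↦ f (-(2 * π) * w)) = fun w ↦ ‖𝓕 g w‖ ^ 2 := by
    funext w
    rw [hF, hf]
    simp only
    congr 3
    push_cast
    ring
  rw [e1, hP] at hsub
  have hpi : |(-(2 * π))⁻¹| = (2 * π)⁻¹ := by
    rw [inv_neg, abs_neg, abs_of_pos (by positivity)]
  rw [hpi, smul_eq_mul] at hsub
  have h2pi : (0 : ℝ) < 2 * π := by positivity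
  unfold weilNorm2Sq
  rw [hsub, ← mul_assoc, mul_inv_cancel₀ h2pi.ne', one_mul]

/-- For `g ∈ L¹ ∩ L²` the density `t ↦ ‖ĝ(1/2 + it)‖²` is integrable on the line. -/
theorem integrable_norm_sq_weilMellin_half_line_of_memLp (h1 : Integrable g) (h2 : MemLp g 2) :
    Integrable fun t : ℝ ↦ ‖weilMellin g (1 / 2 + t * I)‖ ^ 2 := by
  have hF := Literature.Analysis.FunctionSpaces.memLp_two_fourierIntegral h1 h2
  have i1 : Integrable (fun ξ : ℝ ↦ ‖𝓕 g ξ‖ ^ 2) := (memLp_two_iff_integrable_sq_norm hF.1).1 hF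
  have hFw : ∀ t : ℝ, weilMellin g (1 / 2 + t * I) = 𝓕 g (-(2 * π)⁻¹ * t) := by
    intro t
    have h := fourier_weilKernel g (1 / 2) (-(2 * π)⁻¹ * t)
    have e : (fun t : ℝ ↦ g t * cexp ((((1 / 2 : ℝ) : ℂ) - 1 / 2) * t)) = g := by
      funext t; push_cast; simp
    rw [e] at h
    rw [h]
    congr 1
    have hpi : (π : ℝ) ≠ 0 := Real.pi_ne_zero
    push_cast
    field_simp
  have hR : (-(2 * π)⁻¹ : ℝ) ≠ 0 := by
    have : (0 : ℝ) < 2 * π := by positivity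
    exact neg_ne_zero.2 (inv_ne_zero this.ne')
  have h := i1.comp_mul_left' hR
  refine h.congr (Eventually.of_forall fun t ↦ ?_)
  simp only [hFw]

/-! ### Cut window functions and the window transform -/

/-- The cut window function `1_{[-a,a]} v`. -/
noncomputable def windowCut (a : ℝ) (v : ℝ → ℂ) : ℝ → ℂ := (Icc (-a) a).indicator v

/-- The window transform `F_a v (t) = ∫_{-a}^{a} v(x) e^{itx} dx`. -/
noncomputable def windowFT (a : ℝ) (v : ℝ → ℂ) (t : ℝ) : ℂ := ∫ x in (-a)..a, v x * cexp (t * I * x)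

/-- The squared window norm `‖v‖²_{L²(-a,a)} = ∫_{-a}^{a} ‖v‖²`. -/
noncomputable def windowNormSq (a : ℝ) (v : ℝ → ℂ) : ℝ := ∫ x in (-a)..a, ‖v x‖ ^ 2

/-- `(1_{[-a,a]} v)^(1/2 + it) = F_a v (t)` (`a ≥ 0`). -/
theorem weilMellin_windowCut (ha : 0 ≤ a) (v : ℝ → ℂ) (t : ℝ) :
    weilMellin (windowCut a v) (1 / 2 + t * I) = windowFT a v t := by
  rw [show (1 / 2 + t * I : ℂ) = t * I + 1 / 2 by ring, weilMellin_add_half, windowCut, windowFT]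
  have h : (fun x : ℝ ↦ (Icc (-a) a).indicator v x * cexp (t * I * x)) =
      (Icc (-a) a).indicator (fun x ↦ v x * cexp (t * I * x)) := by
    funext x
    by_cases hx : x ∈ Icc (-a) a
    · simp [hx]
    · simp [hx]
  rw [h, integral_indicator measurableSet_Icc, intervalIntegral.integral_of_le (by linarith),
    integral_Icc_eq_integral_Ioc]

/-- A function supported in the window is its own cut: `1_{[-a,a]} g = g`. -/
theorem windowCut_eq_self_of_tsupport (hsupp : tsupport g ⊆ Icc (-a) a) : windowCut a g = g := by
  funext x
  unfold windowCut
  by_cases hx : x ∈ Icc (-a) a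
  · rw [indicator_of_mem hx]
  · rw [indicator_of_notMem hx, eq_zero_of_tsupport_subset hsupp hx]

/-- For a function supported in the window, `F_a g (t) = ĝ(1/2 + it)`. -/
theorem windowFT_eq_weilMellin_of_tsupport (ha : 0 ≤ a) (hsupp : tsupport g ⊆ Icc (-a) a) (t : ℝ) :
    windowFT a g t = weilMellin g (1 / 2 + t * I) := by
  rw [← weilMellin_windowCut ha g t, windowCut_eq_self_of_tsupport hsupp]

/-- For a function supported in the window, `‖g‖²_{L²(-a,a)} = ‖g‖₂²`. -/
theorem windowNormSq_eq_weilNorm2Sq_of_tsupport (ha : 0 ≤ a) (hsupp : tsupport g ⊆ Icc (-a) a) :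
    windowNormSq a g = weilNorm2Sq g := by
  unfold windowNormSq weilNorm2Sq
  rw [intervalIntegral.integral_of_le (by linarith), ← integral_Icc_eq_integral_Ioc,
    ← integral_indicator measurableSet_Icc]
  refine integral_congr_ae (Eventually.of_forall fun x ↦ ?_)
  by_cases hx : x ∈ Icc (-a) a
  · simp [hx]
  · simp [hx, eq_zero_of_tsupport_subset hsupp hx]

/-- `‖1_{[-a,a]} v‖₂² = ‖v‖²_{L²(-a,a)}` (`a ≥ 0`). -/
theorem weilNorm2Sq_windowCut (ha : 0 ≤ a) (v : ℝ → ℂ) : weilNorm2Sq (windowCut a v) = windowNormSq a v := by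
  unfold weilNorm2Sq windowNormSq windowCut
  have h : (fun x : ℝ ↦ ‖(Icc (-a) a).indicator v x‖ ^ 2) = (Icc (-a) a).indicator (fun x ↦ ‖v x‖ ^ 2) := by
    funext x
    by_cases hx : x ∈ Icc (-a) a
    · simp [hx]
    · simp [hx]
  rw [h, integral_indicator measurableSet_Icc, intervalIntegral.integral_of_le (by linarith),
    integral_Icc_eq_integral_Ioc]

/-- The cut of a continuous function is in `L¹`. -/
theorem integrable_windowCut (hv : Continuous v) (a : ℝ) : Integrable (windowCut a v) :=
  (integrable_indicator_iff measurableSet_Icc).2 hv.integrableOn_Icc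

/-- The cut of a continuous function is in `L²`. -/
theorem memLp_two_windowCut (hv : Continuous v) (a : ℝ) : MemLp (windowCut a v) 2 := by
  rw [windowCut, memLp_indicator_iff_restrict measurableSet_Icc,
    memLp_two_iff_integrable_sq_norm hv.aestronglyMeasurable]
  exact (by fun_prop : Continuous fun x ↦ ‖v x‖ ^ 2).integrableOn_Icc

/-- The window transform of a continuous function is continuous in the frequency. -/
theorem continuous_windowFT (hv : Continuous v) (a : ℝ) : Continuous (windowFT a v) := by
  unfold windowFT
  exact intervalIntegral.continuous_parametric_intervalIntegral_of_continuous' (by fun_prop) _ _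

/-- `‖F_a v (t)‖ ≤ ∫_{-a}^{a} ‖v‖` (`a ≥ 0`). -/
theorem norm_windowFT_le (ha : 0 ≤ a) (v : ℝ → ℂ) (t : ℝ) :
    ‖windowFT a v t‖ ≤ ∫ x in (-a)..a, ‖v x‖ := by
  unfold windowFT
  refine (intervalIntegral.norm_integral_le_integral_norm (by linarith)).trans (le_of_eq ?_)
  refine intervalIntegral.integral_congr fun x _ ↦ ?_
  simp only [norm_mul]
  rw [show (t : ℂ) * I * (x : ℂ) = ((t * x : ℝ) : ℂ) * I by push_cast; ring, Complex.norm_exp_ofReal_mul_I,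
    mul_one]

/-- Additivity of the window transform (continuous `u`, `w`). -/
theorem windowFT_add (hu : Continuous u) (hw : Continuous w) (a t : ℝ) :
    windowFT a (u + w) t = windowFT a u t + windowFT a w t := by
  unfold windowFT
  rw [← intervalIntegral.integral_add ((by fun_prop : Continuous fun x : ℝ ↦ u x * cexp (t * I * x)).intervalIntegrable _ _)
    ((by fun_prop : Continuous fun x : ℝ ↦ w x * cexp (t * I * x)).intervalIntegrable _ _)]
  refine intervalIntegral.integral_congr fun x _ ↦ ?_
  simp only [Pi.add_apply]
  ring

/-- The window transform of a difference (continuous `u`, `w`). -/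
theorem windowFT_sub (hu : Continuous u) (hw : Continuous w) (a t : ℝ) :
    windowFT a (u - w) t = windowFT a u t - windowFT a w t := by
  unfold windowFT
  rw [← intervalIntegral.integral_sub ((by fun_prop : Continuous fun x : ℝ ↦ u x * cexp (t * I * x)).intervalIntegrable _ _)
    ((by fun_prop : Continuous fun x : ℝ ↦ w x * cexp (t * I * x)).intervalIntegrable _ _)]
  refine intervalIntegral.integral_congr fun x _ ↦ ?_
  simp only [Pi.sub_apply]
  ring

/-! ### Plancherel's inequality for cut window functions -/

/-- **Plancherel for a cut window function:** `∫ ‖F_a v (t)‖² dt = 2π ‖v‖²_{L²(-a,a)}`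
(`v` continuous, `a ≥ 0`). -/
theorem integral_norm_sq_windowFT (hv : Continuous v) (ha : 0 ≤ a) :
    ∫ t : ℝ, ‖windowFT a v t‖ ^ 2 = 2 * π * windowNormSq a v := by
  rw [← weilNorm2Sq_windowCut ha v, ← integral_norm_sq_weilMellin_half_line_of_memLp
    (integrable_windowCut hv a) (memLp_two_windowCut hv a)]
  exact integral_congr_ae (Eventually.of_forall fun t ↦ by simp only [weilMellin_windowCut ha])

/-- The density `t ↦ ‖F_a v (t)‖²` is integrable on the line (`v` continuous, `a ≥ 0`). -/
theorem integrable_norm_sq_windowFT (hv : Continuous v) (ha : 0 ≤ a) :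
    Integrable fun t : ℝ ↦ ‖windowFT a v t‖ ^ 2 := by
  refine (integrable_norm_sq_weilMellin_half_line_of_memLp (integrable_windowCut hv a)
    (memLp_two_windowCut hv a)).congr (Eventually.of_forall fun t ↦ ?_)
  simp only [weilMellin_windowCut ha]

/-- **Plancherel's inequality (`0 ≤ P ≤ I` on cut window functions):** for `v` continuous, `a ≥ 0`
and any set `S` of frequencies, `0 ≤ ∫_S ‖F_a v‖² ≤ 2π ‖v‖²_{L²(-a,a)}`. -/
theorem setIntegral_norm_sq_windowFT_le (hv : Continuous v) (ha : 0 ≤ a) (S : Set ℝ) :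
    0 ≤ ∫ t in S, ‖windowFT a v t‖ ^ 2 ∧
      ∫ t in S, ‖windowFT a v t‖ ^ 2 ≤ 2 * π * windowNormSq a v := by
  refine ⟨integral_nonneg fun _ ↦ sq_nonneg _, ?_⟩
  rw [← integral_norm_sq_windowFT hv ha]
  exact setIntegral_le_integral (integrable_norm_sq_windowFT hv ha)
    (Eventually.of_forall fun _ ↦ sq_nonneg _)

/-! ### The band form of cut window functions: Cauchy–Schwarz and expansion -/

/-- `t ↦ ‖F_a v (t)‖` is in `L²` of any restricted measure. -/
theorem memLp_two_norm_windowFT (hv : Continuous v) (ha : 0 ≤ a) (S : Set ℝ) :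
    MemLp (fun t : ℝ ↦ ‖windowFT a v t‖) 2 (volume.restrict S) := by
  have hc : Continuous fun t : ℝ ↦ ‖windowFT a v t‖ := (continuous_windowFT hv a).norm
  rw [memLp_two_iff_integrable_sq_norm hc.aestronglyMeasurable]
  refine ((integrable_norm_sq_windowFT hv ha).integrableOn (s := S)).congr
    (Eventually.of_forall fun t ↦ ?_)
  simp only [norm_norm]

/-- **Cauchy–Schwarz for the band form of cut window functions:**
`‖∫_S F_a u · conj (F_a w)‖² ≤ (∫_S ‖F_a u‖²) (∫_S ‖F_a w‖²)`. -/
theorem norm_sq_setIntegral_windowFT_mul_conj_le (hu : Continuous u) (hw : Continuous w)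
    (ha : 0 ≤ a) (S : Set ℝ) :
    ‖∫ t in S, windowFT a u t * conj (windowFT a w t)‖ ^ 2 ≤
      (∫ t in S, ‖windowFT a u t‖ ^ 2) * ∫ t in S, ‖windowFT a w t‖ ^ 2 := by
  set U : ℝ → ℝ := fun t ↦ ‖windowFT a u t‖ with hU
  set W : ℝ → ℝ := fun t ↦ ‖windowFT a w t‖ with hW
  have hU0 : 0 ≤ᵐ[volume.restrict S] U := Eventually.of_forall fun _ ↦ norm_nonneg _
  have hW0 : 0 ≤ᵐ[volume.restrict S] W := Eventually.of_forall fun _ ↦ norm_nonneg _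
  have hUm : MemLp U (ENNReal.ofReal 2) (volume.restrict S) := by
    rw [show ENNReal.ofReal 2 = 2 by norm_num]; exact memLp_two_norm_windowFT hu ha S
  have hWm : MemLp W (ENNReal.ofReal 2) (volume.restrict S) := by
    rw [show ENNReal.ofReal 2 = 2 by norm_num]; exact memLp_two_norm_windowFT hw ha S
  have hH := integral_mul_le_Lp_mul_Lq_of_nonneg Real.HolderConjugate.two_two hU0 hW0 hUm hWm
  have h1 : ‖∫ t in S, windowFT a u t * conj (windowFT a w t)‖ ≤ ∫ t in S, U t * W t := by
    refine (norm_integral_le_integral_norm _).trans (le_of_eq ?_)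
    refine integral_congr_ae (Eventually.of_forall fun t ↦ ?_)
    simp only [hU, hW, norm_mul, Complex.norm_conj]
  have hA0 : 0 ≤ ∫ t in S, U t ^ 2 := integral_nonneg fun _ ↦ sq_nonneg _
  have hB0 : 0 ≤ ∫ t in S, W t ^ 2 := integral_nonneg fun _ ↦ sq_nonneg _
  have hsq : ((∫ t in S, U t ^ (2 : ℝ)) ^ (1 / (2 : ℝ)) * (∫ t in S, W t ^ (2 : ℝ)) ^ (1 / (2 : ℝ))) ^ 2 =
      (∫ t in S, U t ^ 2) * ∫ t in S, W t ^ 2 := by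
    have eU : ∫ t in S, U t ^ (2 : ℝ) = ∫ t in S, U t ^ 2 :=
      integral_congr_ae (Eventually.of_forall fun t ↦ by simp)
    have eW : ∫ t in S, W t ^ (2 : ℝ) = ∫ t in S, W t ^ 2 :=
      integral_congr_ae (Eventually.of_forall fun t ↦ by simp)
    have key : ∀ x : ℝ, 0 ≤ x → (x ^ (1 / (2 : ℝ))) ^ 2 = x := fun x hx ↦ by
      rw [← Real.rpow_natCast, ← Real.rpow_mul hx]; norm_num
    rw [eU, eW, mul_pow, key _ hA0, key _ hB0]
  have h0 : 0 ≤ ‖∫ t in S, windowFT a u t * conj (windowFT a w t)‖ := norm_nonneg _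
  calc ‖∫ t in S, windowFT a u t * conj (windowFT a w t)‖ ^ 2
      ≤ (∫ t in S, U t * W t) ^ 2 := pow_le_pow_left₀ h0 h1 2
    _ ≤ ((∫ t in S, U t ^ (2 : ℝ)) ^ (1 / (2 : ℝ)) * (∫ t in S, W t ^ (2 : ℝ)) ^ (1 / (2 : ℝ))) ^ 2 :=
        pow_le_pow_left₀ (integral_nonneg fun t ↦ mul_nonneg (norm_nonneg _) (norm_nonneg _)) hH 2
    _ = (∫ t in S, U t ^ 2) * ∫ t in S, W t ^ 2 := hsq

/-- The cross density `F_a u · conj (F_a w)` is integrable on the line. -/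
theorem integrable_windowFT_mul_conj (hu : Continuous u) (hw : Continuous w) (ha : 0 ≤ a) :
    Integrable fun t : ℝ ↦ windowFT a u t * conj (windowFT a w t) := by
  have hc : Continuous fun t : ℝ ↦ windowFT a u t * conj (windowFT a w t) :=
    (continuous_windowFT hu a).mul (Complex.continuous_conj.comp (continuous_windowFT hw a))
  refine Integrable.mono' (((integrable_norm_sq_windowFT hu ha).add
    (integrable_norm_sq_windowFT hw ha)).div_const 2) hc.aestronglyMeasurable
    (Eventually.of_forall fun t ↦ ?_)
  rw [norm_mul, Complex.norm_conj]
  simp only [Pi.add_apply]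
  nlinarith [sq_nonneg (‖windowFT a u t‖ - ‖windowFT a w t‖)]

/-- **Expansion of the band form of a sum:** for continuous `u`, `w` and a set `S`:
`∫_S ‖F_a (u + w)‖² = ∫_S ‖F_a u‖² + 2 Re ∫_S F_a u · conj (F_a w) + ∫_S ‖F_a w‖²`. -/
theorem setIntegral_norm_sq_windowFT_add (hu : Continuous u) (hw : Continuous w) (ha : 0 ≤ a)
    (S : Set ℝ) :
    ∫ t in S, ‖windowFT a (u + w) t‖ ^ 2 =
      (∫ t in S, ‖windowFT a u t‖ ^ 2) +
        2 * (∫ t in S, windowFT a u t * conj (windowFT a w t)).re +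
        ∫ t in S, ‖windowFT a w t‖ ^ 2 := by
  have hpt : ∀ t : ℝ, ‖windowFT a (u + w) t‖ ^ 2 =
      ‖windowFT a u t‖ ^ 2 + 2 * (windowFT a u t * conj (windowFT a w t)).re +
        ‖windowFT a w t‖ ^ 2 := fun t ↦ by
    rw [windowFT_add hu hw, Complex.sq_norm, Complex.sq_norm, Complex.sq_norm, Complex.normSq_add]
    ring
  have hiU := (integrable_norm_sq_windowFT hu ha).integrableOn (s := S)
  have hiW := (integrable_norm_sq_windowFT hw ha).integrableOn (s := S)
  have hiX := (integrable_windowFT_mul_conj hu hw ha).integrableOn (s := S)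
  have hiXre : IntegrableOn (fun t : ℝ ↦ 2 * (windowFT a u t * conj (windowFT a w t)).re) S :=
    (hiX.re).const_mul 2
  have hi1 : IntegrableOn (fun t : ℝ ↦ ‖windowFT a u t‖ ^ 2 +
      2 * (windowFT a u t * conj (windowFT a w t)).re) S := hiU.add hiXre
  have hre : ∫ t in S, (windowFT a u t * conj (windowFT a w t)).re =
      (∫ t in S, windowFT a u t * conj (windowFT a w t)).re := by
    have h := integral_re hiX
    simpa only [RCLike.re_to_complex] using h
  simp_rw [hpt]
  rw [integral_add hi1 hiW, integral_add hiU hiXre, MeasureTheory.integral_const_mul, hre]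

end Summit.RiemannHypothesis.RiemannHypothesis.Theorems
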